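import Summits.KontsevichZagierPeriods.KontsevichZagierPeriods.Theorems.RootDecompWalshStrataEtypeAtoms

/-!
# Root decomposition (Walsh strata), part 44 — P-type fibre discriminants I: boundary sections on a wall locus

Parts 44–46 close the **rank `≤ 1` residual `R-P`** (`disc D = 0`) of the typed residual form
`quadricBakerDescent_of_residuals` (part 43): for a ternary quadric `K` whose fibre discriminant `D(x, y)`
has a quadratic part with vanishing discriminant, `[atom, γ√D] ∈ InBaker` for EVERY atom of the wall family
and every sign vector, with no side condition.  After a rational shear `D` becomes the P-TYPE RADICAND
`ε·Y + (eX² + fX + g)`; the planar-sections engine (`InBaker.of_planar_sections`, part 19) integrates in `Y`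
first with an explicit algebraic potential (`(2γ/3ε)·D·√D` if `ε ≠ 0`, `γ√(eX² + fX + g)·Y` if `ε = 0`), and
its boundary sections lie over the WALL LOCUS (part 41) of the piece.

This part is the generic SECTION DISPATCHER `InBaker.of_wall_sections` (44.2): a section `[S, Φ(x, ζ x)]`
over the graph of a semialgebraic `ζ` inside the frontier of an open piece `W ⊆ [0,1]²`, whose frontier lies
on `wallLocus R ℓ q`, splits (rule (1)) into finitely many semialgebraic pieces — `R = 0` along the graph;
the graph on a genuine listed line (`k₂ ≠ 0`: `ζ` is rational-affine in `x`; `k₂ = 0`: a null base); the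
graph on a listed conic wall `R = q²` with a definite sign of `q` — each handed to a callback stated over
bases `T ⊆ [0,1]`.  44.1 is the semialgebraic bookkeeping for walls along graphs.

References: [KontsevichZagier2001 §1.2 rules (1)–(3)], [BCR1998 §2.2].
-/

noncomputable section

open Set MeasureTheory MvPolynomial Literature.NumberTheory.Transcendental
open Literature.ModelTheory.ExponentialFields (IsSemialgebraic isSemialgebraic_univ isSemialgebraic_empty)

namespace Summit.KontsevichZagierPeriods.RootDecompWalshStrata.ConicDescent.BallCube

/-! #### 44.1 Walls along graphs -/

/-- `(x, t)₀ = x₀` on `Fin 2`. [bookkeeping] -/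
private theorem snoc₂_zero (x : Fin 1 → ℝ) (t : ℝ) : (Fin.snoc x t : Fin 2 → ℝ) 0 = x 0 := rfl

/-- `(x, t)₁ = t` on `Fin 2`. [bookkeeping] -/
private theorem snoc₂_one (x : Fin 1 → ℝ) (t : ℝ) : (Fin.snoc x t : Fin 2 → ℝ) 1 = t := rfl

/-- A wall evaluated along the graph of a semialgebraic function is semialgebraic on the base. [BCR1998 §2.2] -/
theorem Wall.isSemialgebraicFunOn_eval_graph (L : Wall) {S : Set (Fin 1 → ℝ)} (hS : IsSemialgebraic ℚ S)
    {ζ : (Fin 1 → ℝ) → ℝ} (hζ : IsSemialgebraicFunOn ℚ S ζ) :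
    IsSemialgebraicFunOn ℚ S fun x => L.eval (x 0) (ζ x) :=
  (isSemialgebraicFunOn_comp_snoc (N := 1) hS (L.isSemialgebraicFunOn_eval isSemialgebraic_univ) hζ).congr
    fun _ _ => rfl

/-- On a genuine line with `k₂ ≠ 0`, the second coordinate is rational-affine in the first. [bookkeeping] -/
theorem Wall.eq_of_eval_eq_zero (L : Wall) (h2 : L.k2 ≠ 0) {x y : ℝ} (h : L.eval x y = 0) :
    y = -((L.k0 : ℝ) + L.k1 * x) / L.k2 := by
  have h2' : (L.k2 : ℝ) ≠ 0 := by exact_mod_cast h2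
  rw [Wall.eval] at h
  field_simp
  linarith

/-- Bases of boundary sections of a piece of the unit square lie in `[0, 1]`. [bookkeeping] -/
theorem subset_Icc_of_graph_frontier {W : Set (Fin 2 → ℝ)} (hWI : W ⊆ Icc 0 1) {S : Set (Fin 1 → ℝ)}
    {ζ : (Fin 1 → ℝ) → ℝ} (hgr : ∀ x ∈ S, (Fin.snoc x (ζ x) : Fin 2 → ℝ) ∈ frontier W)
    {T : Set (Fin 1 → ℝ)} (hT : T ⊆ S) : T ⊆ Icc 0 1 := by
  have hclI : closure W ⊆ Icc 0 1 := closure_minimal hWI isClosed_Icc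
  intro x hx
  have h := hclI (frontier_subset_closure (hgr x (hT hx)))
  have h0 : 0 ≤ x 0 ∧ x 0 ≤ 1 := ⟨by simpa using h.1 0, by simpa using h.2 0⟩
  exact ⟨fun j => by rw [Subsingleton.elim j 0]; exact h0.1, fun j => by rw [Subsingleton.elim j 0]; exact h0.2⟩

/-! #### 44.2 The section dispatcher -/

/-- **BOUNDARY SECTIONS ON A WALL LOCUS (rule (1)).**  Let `W ⊆ [0,1]²` be open with
`closure W ∖ W ⊆ wallLocus R ℓ q`, and let `[S, x ↦ Φ(x, ζ x)]` be a boundary section of the planar-sections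
engine (`ζ` semialgebraic on `S`, graph in `frontier W`).  If the three kinds of pieces are in the Baker
sector — (0) bases `T` over which `R(x, ζ x) = 0`; (L) bases over which the graph lies on a listed line with
`k₂ ≠ 0`, so that `ζ x = −(k₀ + k₁x)/k₂`; (C) bases over which `R(x, ζ x) = q_j(x, ζ x)²` with
`s·q_j(x, ζ x) ≥ 0` for a fixed sign `s = ±1` — then so is the section (bases on genuine lines with `k₂ = 0`
are null and need no callback). [KontsevichZagier2001 §1.2 rule (1); this node] -/
theorem InBaker.of_wall_sections (R : (Fin 2 → ℝ) → ℝ) (hR : IsSemialgebraicFunOn ℚ univ R) {n m : ℕ}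
    (ℓ : Fin n → Wall) (q : Fin m → Wall) {W : Set (Fin 2 → ℝ)} (hWo : IsOpen W) (hWI : W ⊆ Icc 0 1)
    (hfr : ∀ w ∈ closure W, w ∉ W → w ∈ wallLocus R ℓ q)
    {S : Set (Fin 1 → ℝ)} {ζ : (Fin 1 → ℝ) → ℝ} (hS : IsSemialgebraic ℚ S)
    (hζ : IsSemialgebraicFunOn ℚ S ζ) (hgr : ∀ x ∈ S, (Fin.snoc x (ζ x) : Fin 2 → ℝ) ∈ frontier W)
    (r₁ : KZ.IntegralRep 1) (hr₁d : r₁.domain = S)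
    (h0 : ∀ (T : Set (Fin 1 → ℝ)) (hT : IsSemialgebraic ℚ T) (hTr : T ⊆ r₁.domain), T ⊆ Icc 0 1 →
      (∀ x ∈ T, R (Fin.snoc x (ζ x)) = 0) → InBaker (KZ.of (r₁.restrict T hT hTr)))
    (hl : ∀ (i : Fin n) (T : Set (Fin 1 → ℝ)) (hT : IsSemialgebraic ℚ T) (hTr : T ⊆ r₁.domain),
      T ⊆ Icc 0 1 → (ℓ i).k2 ≠ 0 →
      (∀ x ∈ T, ζ x = -(((ℓ i).k0 : ℝ) + (ℓ i).k1 * x 0) / (ℓ i).k2) →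
      InBaker (KZ.of (r₁.restrict T hT hTr)))
    (hc : ∀ (j : Fin m) (s : ℚ), s = 1 ∨ s = -1 →
      ∀ (T : Set (Fin 1 → ℝ)) (hT : IsSemialgebraic ℚ T) (hTr : T ⊆ r₁.domain), T ⊆ Icc 0 1 →
      IsSemialgebraicFunOn ℚ T ζ →
      (∀ x ∈ T, R (Fin.snoc x (ζ x)) = ((q j).eval (x 0) (ζ x)) ^ 2 ∧
        0 ≤ (s : ℝ) * (q j).eval (x 0) (ζ x)) →
      InBaker (KZ.of (r₁.restrict T hT hTr))) :
    InBaker (KZ.of r₁) := by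
  classical
  have hTI : ∀ T, T ⊆ S → T ⊆ Icc (0 : Fin 1 → ℝ) 1 := fun T hT =>
    subset_Icc_of_graph_frontier hWI hgr hT
  -- semialgebraic functions along the graph of `ζ`
  have hRζ : IsSemialgebraicFunOn ℚ S fun x => R (Fin.snoc x (ζ x)) :=
    isSemialgebraicFunOn_comp_snoc (N := 1) hS hR hζ
  have hLζ : ∀ L : Wall, IsSemialgebraicFunOn ℚ S fun x => L.eval (x 0) (ζ x) := fun L =>
    L.isSemialgebraicFunOn_eval_graph hS hζ
  -- the pieces
  let Z : Set (Fin 1 → ℝ) := {x | x ∈ S ∧ R (Fin.snoc x (ζ x)) = ((0 : ℚ) : ℝ)}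
  let Al : Fin n → Set (Fin 1 → ℝ) := fun i =>
    {x | x ∈ S ∧ (ℓ i).eval (x 0) (ζ x) = ((0 : ℚ) : ℝ) ∧ ((ℓ i).k1 ≠ 0 ∨ (ℓ i).k2 ≠ 0)}
  let Ap : Fin m → Set (Fin 1 → ℝ) := fun j =>
    {x | x ∈ S ∧ R (Fin.snoc x (ζ x)) = (q j).eval (x 0) (ζ x) * (q j).eval (x 0) (ζ x)} ∩
      {x | x ∈ S ∧ 0 ≤ (q j).eval (x 0) (ζ x)}
  let An : Fin m → Set (Fin 1 → ℝ) := fun j =>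
    {x | x ∈ S ∧ R (Fin.snoc x (ζ x)) = (q j).eval (x 0) (ζ x) * (q j).eval (x 0) (ζ x)} ∩
      {x | x ∈ S ∧ 0 ≤ -(q j).eval (x 0) (ζ x)}
  let A : Option (Fin n ⊕ (Fin m ⊕ Fin m)) → Set (Fin 1 → ℝ) := fun o =>
    o.elim Z fun u => u.elim Al fun v => v.elim Ap An
  have hZ : IsSemialgebraic ℚ Z := isSemialgebraic_sep_eq hRζ (isSemialgebraicFunOn_ratCast hS 0)
  have hAl : ∀ i, IsSemialgebraic ℚ (Al i) := by
    intro i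
    by_cases hg : (ℓ i).k1 ≠ 0 ∨ (ℓ i).k2 ≠ 0
    · have := isSemialgebraic_sep_eq (hLζ (ℓ i)) (isSemialgebraicFunOn_ratCast hS 0)
      convert this using 1
      ext x
      simp only [Al, mem_setOf_eq, hg, and_true]
    · have : Al i = ∅ := eq_empty_of_forall_notMem fun x hx => hg hx.2.2
      rw [this]; exact isSemialgebraic_empty
  have hsq : ∀ j, IsSemialgebraic ℚ
      {x | x ∈ S ∧ R (Fin.snoc x (ζ x)) = (q j).eval (x 0) (ζ x) * (q j).eval (x 0) (ζ x)} := fun j =>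
    isSemialgebraic_sep_eq hRζ ((hLζ (q j)).mul_holds (hLζ (q j)))
  have hAp : ∀ j, IsSemialgebraic ℚ (Ap j) := fun j =>
    (hsq j).inter (hLζ (q j)).isSemialgebraic_sep_nonneg
  have hAn : ∀ j, IsSemialgebraic ℚ (An j) := fun j =>
    (hsq j).inter (hLζ (q j)).neg.isSemialgebraic_sep_nonneg
  refine InBaker.of_cover' r₁ A ?_ ?_ ?_
  · rintro (_ | i | j | j)
    · exact hZ
    · exact hAl i
    · exact hAp j
    · exact hAn j
  · -- the cover: the graph point is a frontier point of `W`, hence on the wall locus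
    intro x hx
    have hxS : x ∈ S := by rw [← hr₁d]; exact hx
    have hfx := hgr x hxS
    rw [hWo.frontier_eq] at hfx
    rcases hfr _ hfx.1 hfx.2 with h | ⟨i, hg, hi⟩ | ⟨j, hj⟩
    · exact mem_iUnion.2 ⟨none, hxS, by simpa using h⟩
    · refine mem_iUnion.2 ⟨some (Sum.inl i), hxS, ?_, hg⟩
      simpa only [snoc₂_zero, snoc₂_one, Rat.cast_zero] using hi
    · rw [snoc₂_zero, snoc₂_one, sq] at hj
      rcases le_or_gt 0 ((q j).eval (x 0) (ζ x)) with hs | hs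
      · exact mem_iUnion.2 ⟨some (Sum.inr (Sum.inl j)), ⟨hxS, hj⟩, hxS, hs⟩
      · exact mem_iUnion.2 ⟨some (Sum.inr (Sum.inr j)), ⟨hxS, hj⟩, hxS, by linarith⟩
  · rintro (_ | i | j | j) T hT hTr hTA
    · -- `R = 0` along the graph
      have hTS : T ⊆ S := fun x hx => (hTA hx).1
      exact h0 T hT hTr (hTI T hTS) fun x hx => by simpa using (hTA hx).2
    · -- a genuine listed line
      by_cases hT0 : T = ∅
      · exact InBaker.of_domain_eq_empty _ hT0
      obtain ⟨x₀, hx₀⟩ := nonempty_iff_ne_empty.2 hT0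
      have hTS : T ⊆ S := fun x hx => (hTA hx).1
      have hg : (ℓ i).k1 ≠ 0 ∨ (ℓ i).k2 ≠ 0 := (hTA hx₀).2.2
      have hev : ∀ x ∈ T, (ℓ i).eval (x 0) (ζ x) = 0 := fun x hx => by
        simpa only [Rat.cast_zero] using (hTA hx).2.1
      by_cases h2 : (ℓ i).k2 ≠ 0
      · exact hl i T hT hTr (hTI T hTS) h2 fun x hx => (ℓ i).eq_of_eval_eq_zero h2 (hev x hx)
      · -- `k₂ = 0`, `k₁ ≠ 0`: the base lies in the zero set of `k₀ + k₁ x`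
        rw [not_not] at h2
        have h1 : (ℓ i).k1 ≠ 0 := hg.resolve_right (not_not.2 h2)
        have h1' : ((ℓ i).k1 : ℝ) ≠ 0 := by exact_mod_cast h1
        refine InBaker.of_subset_zeroSet _ (C (ℓ i).k0 + C (ℓ i).k1 * X 0)
          ⟨fun _ => -((ℓ i).k0 / (ℓ i).k1) + 1, ?_⟩ fun x hx => ?_
        · simp only [map_add, map_mul, MvPolynomial.aeval_C, MvPolynomial.aeval_X, eq_ratCast]
          field_simp
          intro h
          exact h1' (by linarith)
        · have h := hev x hx
          rw [Wall.eval, h2] at h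
          simp only [map_add, map_mul, MvPolynomial.aeval_C, MvPolynomial.aeval_X, eq_ratCast]
          show ((ℓ i).k0 : ℝ) + (ℓ i).k1 * x 0 = 0
          simpa using h
    · -- a conic wall, `q ≥ 0`
      have hTS : T ⊆ S := fun x hx => (hTA hx).1.1
      exact hc j 1 (Or.inl rfl) T hT hTr (hTI T hTS) (hζ.mono hTS hT) fun x hx =>
        ⟨by rw [(hTA hx).1.2, sq], by rw [Rat.cast_one, one_mul]; exact (hTA hx).2.2⟩
    · -- a conic wall, `q ≤ 0`
      have hTS : T ⊆ S := fun x hx => (hTA hx).1.1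
      exact hc j (-1) (Or.inr rfl) T hT hTr (hTI T hTS) (hζ.mono hTS hT) fun x hx =>
        ⟨by rw [(hTA hx).1.2, sq], by
          rw [Rat.cast_neg, Rat.cast_one, neg_one_mul]; exact (hTA hx).2.2⟩

end Summit.KontsevichZagierPeriods.RootDecompWalshStrata.ConicDescent.BallCube

end
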